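import Literature.AlgebraicGeometry.Deformation.SmoothSchemeLiftObstructionCriterionGlueTransition
import HarnessLib

/-!
# Gluing the lifted charts, VI: change of the coefficient ring `R → R'` on charts and transition maps
# (Hartshorne, *Deformation Theory*, proof of Thm. 10.2 (a); base change of the glued deformation)

HOME SEED (cell `hodgecm-mathlib`, F-11 (A3) F3b FILE 4a; provisional path
`Deformation/SmoothSchemeLiftObstructionCriterionGlueBaseChange.lean`).  Theorems only; imports FILE 1b.

For a `k`-algebra map `σ : R → R'` (e.g. the reduction `A → A⧸J` of a small extension, or `A → k`), the chart
`Spec (R' ⊗_k Γ(V₀))` maps to the chart `Spec (R ⊗_k Γ(V₀))` by `φ = Spec (σ ⊗ 1)`.  With all maps CHARACTERISED as in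
FILE 1a/1b (`σ̂ (r ⊗ c) = σ r ⊗ c`), THIS FILE proves the three compatibilities that make `(φ_j)` a MORPHISM OF GLUE DATA
with cartesian charts (★ `Morphisms/GlueDataOverBase` §2) between the glue data of FILE 2 over `R'` and over `R`:

* `SpecMap_baseChange_comp_chart` — `φ ≫ p_R = p_{R'}` (the chart projections are compatible), hence
  `φ⁻¹(p_R⁻¹ V) = p_{R'}⁻¹ V` (the overlaps correspond: CARTESIAN chart squares);
* `comp_chartRingHom_baseChange` — the chart ring maps are natural: `a^* ∘ Λ_R = Λ_{R'} ∘ σ̂` for `a : O' → O` over `φ`;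
* **`baseChange_transition`** — the transition maps are natural: `a ≫ t_R = t_{R'} ≫ φ₁` as soon as the lifted transition
  automorphisms are compatible, `σ̂ ∘ ψ = ψ' ∘ σ̂` (for the reduction `A → A⧸J` this is «`ψ₁ ≡ ψ (mod J)` lifts the SAME
  datum», F3a's output clause).

HC_CM is proved only modulo the 7 printed citations until rung 0 closes — nothing here bears on a summit statement.

## References
* [Hartshorne2010] R. Hartshorne, *Deformation Theory*, GTM 257, Springer (2010): Thm. 10.2 (a) and its proof (p. 81).
* [StacksProject] The Stacks Project, Tag 01JA (glueing schemes; functoriality), Tag 01LH (relative glueing).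
* [AtiyahMacdonald1969] M. Atiyah, I. Macdonald, *Introduction to Commutative Algebra* (1969), Ch. 2 (tensor product of
  algebras, pp. 30–31).
-/

noncomputable section

-- `TopCat.Presheaf`/`TopCat.Sheaf` are not reducible (as in Mathlib's `AlgebraicGeometry/Modules`).
set_option backward.isDefEq.respectTransparency false

open CategoryTheory AlgebraicGeometry Opposite TopologicalSpace
open scoped TensorProduct

universe u

namespace Literature.AlgebraicGeometry.Deformation

open Literature.AlgebraicGeometry.Motives

variable {k : Type u} [Field k] {X : Over (Spec (CommRingCat.of k))}
  [instΓ : ∀ W : X.left.Opens, Algebra k Γ(X.left, W)]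
  (halg : ∀ (W : X.left.Opens) (s : k), algebraMap k Γ(X.left, W) s = (constToPresheaf X).app (op W) s)
  {R R' : Type u} [CommRing R] [Algebra k R] [CommRing R'] [Algebra k R'] (σ : R →ₐ[k] R')
  {V₀ V₁ : X.left.Opens} (hV₀ : IsAffineOpen V₀) (hV₁ : IsAffineOpen V₁)
  (p₀ : Spec (CommRingCat.of (R ⊗[k] Γ(X.left, V₀))) ⟶ X.left)
  (hp₀ : p₀ = Spec.map (CommRingCat.ofHom
    (Algebra.TensorProduct.includeRight (R := k) (A := R) (B := Γ(X.left, V₀))).toRingHom) ≫ hV₀.fromSpec)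
  (p₀' : Spec (CommRingCat.of (R' ⊗[k] Γ(X.left, V₀))) ⟶ X.left)
  (hp₀' : p₀' = Spec.map (CommRingCat.ofHom
    (Algebra.TensorProduct.includeRight (R := k) (A := R') (B := Γ(X.left, V₀))).toRingHom) ≫ hV₀.fromSpec)
  {σ₀ : R ⊗[k] Γ(X.left, V₀) →+* R' ⊗[k] Γ(X.left, V₀)} (hσ₀ : ∀ r c, σ₀ (r ⊗ₜ c) = σ r ⊗ₜ c)

/-! ## §1 The chart projections are compatible with the change of coefficients -/

omit instΓ in
/-- `σ̂ ∘ (c ↦ 1 ⊗ c) = (c ↦ 1 ⊗ c)`. [cite: AtiyahMacdonald1969, Ch. 2 (tensor product of algebras, pp. 30–31)] -/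
theorem baseChange_comp_includeRight [∀ W : X.left.Opens, Algebra k Γ(X.left, W)] {V : X.left.Opens}
    {σV : R ⊗[k] Γ(X.left, V) →+* R' ⊗[k] Γ(X.left, V)} (hσV : ∀ r c, σV (r ⊗ₜ c) = σ r ⊗ₜ c) :
    σV.comp (Algebra.TensorProduct.includeRight (R := k) (A := R) (B := Γ(X.left, V))).toRingHom =
      (Algebra.TensorProduct.includeRight (R := k) (A := R') (B := Γ(X.left, V))).toRingHom := by
  refine RingHom.ext fun c => ?_
  change σV (1 ⊗ₜ c) = 1 ⊗ₜ c
  rw [hσV, map_one]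

include hp₀ hp₀' hσ₀ in
/-- **The chart projections are compatible**: `Spec (σ ⊗ 1) ≫ p_R = p_{R'}`. [cite: Hartshorne2010, Thm. 10.2 (proof), p. 81] [cite: StacksProject, Tag 01JA] -/
theorem SpecMap_baseChange_comp_chart : Spec.map (CommRingCat.ofHom σ₀) ≫ p₀ = p₀' := by
  rw [hp₀, hp₀', ← Spec.map_comp_assoc, ← CommRingCat.ofHom_comp, baseChange_comp_includeRight σ hσ₀]

include hp₀ hp₀' hσ₀ in
/-- The overlaps correspond: `(Spec (σ ⊗ 1))⁻¹(p_R⁻¹ V) = p_{R'}⁻¹ V`. [cite: StacksProject, Tag 01JA] -/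
theorem preimage_SpecMap_baseChange (V : X.left.Opens) : Spec.map (CommRingCat.ofHom σ₀) ⁻¹ᵁ (p₀ ⁻¹ᵁ V) = p₀' ⁻¹ᵁ V := by
  rw [← Scheme.Hom.comp_preimage, SpecMap_baseChange_comp_chart σ hV₀ p₀ hp₀ p₀' hp₀' hσ₀]

/-! ## §2 The chart ring maps are natural in the coefficient ring -/

include hp₀ hp₀' hσ₀ in
/-- **Naturality of the chart ring maps**: for opens `O ⊆ Spec (R ⊗_k Γ(V₀))`, `O' ⊆ Spec (R' ⊗_k Γ(V₀))` over `V` and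
`a : O' → O` over `φ = Spec (σ ⊗ 1)`, `a^* ∘ Λ_O = Λ_{O'} ∘ σ̂`. [cite: Hartshorne2010, Thm. 10.2 (proof), p. 81]
[cite: AtiyahMacdonald1969, Ch. 2 (tensor product of algebras, pp. 30–31)] -/
theorem comp_chartRingHom_baseChange {V : X.left.Opens}
    {O : (Spec (CommRingCat.of (R ⊗[k] Γ(X.left, V₀)))).Opens} {O' : (Spec (CommRingCat.of (R' ⊗[k] Γ(X.left, V₀)))).Opens}
    (a : (O' : Scheme.{u}) ⟶ O) (ha : a ≫ O.ι = O'.ι ≫ Spec.map (CommRingCat.ofHom σ₀))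
    {hO : ⊤ ≤ (O.ι ≫ p₀) ⁻¹ᵁ V} {hO' : ⊤ ≤ (O'.ι ≫ p₀') ⁻¹ᵁ V}
    {Λ : R ⊗[k] Γ(X.left, V) →+* Γ(↑O, ⊤)}
    (h₁ : ∀ r : R, Λ (r ⊗ₜ 1) = O.ι.appTop ((Scheme.ΓSpecIso (CommRingCat.of (R ⊗[k] Γ(X.left, V₀)))).inv (r ⊗ₜ 1)))
    (h₂ : ∀ c : Γ(X.left, V), Λ (1 ⊗ₜ c) = (O.ι ≫ p₀).appLE V ⊤ hO c)
    {Λ' : R' ⊗[k] Γ(X.left, V) →+* Γ(↑O', ⊤)}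
    (h₁' : ∀ r : R', Λ' (r ⊗ₜ 1) =
      O'.ι.appTop ((Scheme.ΓSpecIso (CommRingCat.of (R' ⊗[k] Γ(X.left, V₀)))).inv (r ⊗ₜ 1)))
    (h₂' : ∀ c : Γ(X.left, V), Λ' (1 ⊗ₜ c) = (O'.ι ≫ p₀').appLE V ⊤ hO' c)
    {σV : R ⊗[k] Γ(X.left, V) →+* R' ⊗[k] Γ(X.left, V)} (hσV : ∀ r c, σV (r ⊗ₜ c) = σ r ⊗ₜ c) :
    a.appTop.hom.comp Λ = Λ'.comp σV := by
  have haO : O.ι.appTop ≫ a.appTop = (Spec.map (CommRingCat.ofHom σ₀)).appTop ≫ O'.ι.appTop := by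
    rw [← Scheme.Hom.comp_appTop, ha, Scheme.Hom.comp_appTop]
  have hnat : CommRingCat.ofHom σ₀ ≫ (Scheme.ΓSpecIso (CommRingCat.of (R' ⊗[k] Γ(X.left, V₀)))).inv =
      (Scheme.ΓSpecIso (CommRingCat.of (R ⊗[k] Γ(X.left, V₀)))).inv ≫ (Spec.map (CommRingCat.ofHom σ₀)).appTop :=
    Scheme.ΓSpecIso_inv_naturality _
  have hproj : a ≫ O.ι ≫ p₀ = O'.ι ≫ p₀' := by
    rw [← Category.assoc, ha, Category.assoc, SpecMap_baseChange_comp_chart σ hV₀ p₀ hp₀ p₀' hp₀' hσ₀]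
  refine ringHom_ext_tmul (fun r => ?_) (fun c => ?_)
  · calc (a.appTop.hom.comp Λ) (r ⊗ₜ 1)
        = a.appTop (O.ι.appTop ((Scheme.ΓSpecIso (CommRingCat.of (R ⊗[k] Γ(X.left, V₀)))).inv (r ⊗ₜ 1))) :=
          congrArg (fun y => a.appTop y) (h₁ r)
      _ = (O.ι.appTop ≫ a.appTop) ((Scheme.ΓSpecIso (CommRingCat.of (R ⊗[k] Γ(X.left, V₀)))).inv (r ⊗ₜ 1)) :=
          (CommRingCat.comp_apply _ _ _).symm
      _ = ((Scheme.ΓSpecIso (CommRingCat.of (R ⊗[k] Γ(X.left, V₀)))).inv ≫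
            (Spec.map (CommRingCat.ofHom σ₀)).appTop ≫ O'.ι.appTop) (r ⊗ₜ 1) := by
          rw [haO]; exact (CommRingCat.comp_apply _ _ _).symm
      _ = ((CommRingCat.ofHom σ₀ ≫ (Scheme.ΓSpecIso (CommRingCat.of (R' ⊗[k] Γ(X.left, V₀)))).inv) ≫ O'.ι.appTop)
            (r ⊗ₜ 1) := by rw [hnat, Category.assoc]
      _ = O'.ι.appTop ((Scheme.ΓSpecIso (CommRingCat.of (R' ⊗[k] Γ(X.left, V₀)))).inv (σ₀ (r ⊗ₜ 1))) :=
          (CommRingCat.comp_apply _ _ _).trans (congrArg (fun y => O'.ι.appTop y) (CommRingCat.comp_apply _ _ _))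
      _ = O'.ι.appTop ((Scheme.ΓSpecIso (CommRingCat.of (R' ⊗[k] Γ(X.left, V₀)))).inv (σ r ⊗ₜ 1)) := by
          rw [hσ₀]
      _ = Λ' (σ r ⊗ₜ 1) := (h₁' (σ r)).symm
      _ = (Λ'.comp σV) (r ⊗ₜ 1) := by rw [RingHom.comp_apply, hσV]
  · have E : (O.ι ≫ p₀).appLE V ⊤ hO ≫ a.appTop = (O'.ι ≫ p₀').appLE V ⊤ hO' := by
      rw [Scheme.Hom.appTop, Scheme.Hom.app_eq_appLE, Scheme.Hom.appLE_comp_appLE, appLE_eq_of_eq hproj]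
      rfl
    calc (a.appTop.hom.comp Λ) (1 ⊗ₜ c)
        = a.appTop ((O.ι ≫ p₀).appLE V ⊤ hO c) := congrArg (fun y => a.appTop y) (h₂ c)
      _ = ((O.ι ≫ p₀).appLE V ⊤ hO ≫ a.appTop) c := (CommRingCat.comp_apply _ _ _).symm
      _ = ((O'.ι ≫ p₀').appLE V ⊤ hO') c := congrArg (fun φ : Γ(X.left, V) ⟶ Γ(↑O', ⊤) => φ c) E
      _ = Λ' (1 ⊗ₜ c) := (h₂' c).symm
      _ = (Λ'.comp σV) (1 ⊗ₜ c) := by rw [RingHom.comp_apply, hσV, map_one]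

/-! ## §3 The transition maps are natural in the coefficient ring -/

set_option maxHeartbeats 400000 in
include hp₀ hp₀' hσ₀ in
/-- **Naturality of the transition maps**: with `W ⊆ Spec (R ⊗_k Γ(V₀))`, `W' ⊆ Spec (R' ⊗_k Γ(V₀))` over `V₀ ∩ V₁`,
`a : W' → W` over `Spec (σ ⊗ 1)`, chart ring maps `Λ, Λ'`, base changes `Φ, Φ'` and lifted transition automorphisms
`ψ, ψ'` that are COMPATIBLE (`σ̂ ∘ ψ = ψ' ∘ σ̂`), the transition maps satisfy `a ≫ t_R = t_{R'} ≫ Spec (σ ⊗ 1)`.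
[cite: StacksProject, Tag 01JA] [cite: Hartshorne2010, Thm. 10.2 (proof), p. 81] -/
theorem baseChange_transition
    {W : (Spec (CommRingCat.of (R ⊗[k] Γ(X.left, V₀)))).Opens} {W' : (Spec (CommRingCat.of (R' ⊗[k] Γ(X.left, V₀)))).Opens}
    (a : (W' : Scheme.{u}) ⟶ W) (ha : a ≫ W.ι = W'.ι ≫ Spec.map (CommRingCat.ofHom σ₀))
    {hW : ⊤ ≤ (W.ι ≫ p₀) ⁻¹ᵁ (V₀ ⊓ V₁)} {hW' : ⊤ ≤ (W'.ι ≫ p₀') ⁻¹ᵁ (V₀ ⊓ V₁)}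
    {Λ : R ⊗[k] Γ(X.left, V₀ ⊓ V₁) →+* Γ(↑W, ⊤)}
    (h₁ : ∀ r : R, Λ (r ⊗ₜ 1) = W.ι.appTop ((Scheme.ΓSpecIso (CommRingCat.of (R ⊗[k] Γ(X.left, V₀)))).inv (r ⊗ₜ 1)))
    (h₂ : ∀ c : Γ(X.left, V₀ ⊓ V₁), Λ (1 ⊗ₜ c) = (W.ι ≫ p₀).appLE (V₀ ⊓ V₁) ⊤ hW c)
    {Λ' : R' ⊗[k] Γ(X.left, V₀ ⊓ V₁) →+* Γ(↑W', ⊤)}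
    (h₁' : ∀ r : R', Λ' (r ⊗ₜ 1) =
      W'.ι.appTop ((Scheme.ΓSpecIso (CommRingCat.of (R' ⊗[k] Γ(X.left, V₀)))).inv (r ⊗ₜ 1)))
    (h₂' : ∀ c : Γ(X.left, V₀ ⊓ V₁), Λ' (1 ⊗ₜ c) = (W'.ι ≫ p₀').appLE (V₀ ⊓ V₁) ⊤ hW' c)
    {σ₀₁ : R ⊗[k] Γ(X.left, V₀ ⊓ V₁) →+* R' ⊗[k] Γ(X.left, V₀ ⊓ V₁)} (hσ₀₁ : ∀ r c, σ₀₁ (r ⊗ₜ c) = σ r ⊗ₜ c)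
    {σ₁ : R ⊗[k] Γ(X.left, V₁) →+* R' ⊗[k] Γ(X.left, V₁)} (hσ₁ : ∀ r c, σ₁ (r ⊗ₜ c) = σ r ⊗ₜ c)
    (ψ : R ⊗[k] Γ(X.left, V₀ ⊓ V₁) ≃ₐ[R] R ⊗[k] Γ(X.left, V₀ ⊓ V₁))
    (ψ' : R' ⊗[k] Γ(X.left, V₀ ⊓ V₁) ≃ₐ[R'] R' ⊗[k] Γ(X.left, V₀ ⊓ V₁)) (hψσ : ∀ x, σ₀₁ (ψ x) = ψ' (σ₀₁ x))
    {Φ : R ⊗[k] Γ(X.left, V₁) →ₐ[R] R ⊗[k] Γ(X.left, V₀ ⊓ V₁)}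
    (hΦ : ∀ a s, Φ (a ⊗ₜ s) = a ⊗ₜ X.left.presheaf.map (homOfLE inf_le_right).op s)
    {Φ' : R' ⊗[k] Γ(X.left, V₁) →ₐ[R'] R' ⊗[k] Γ(X.left, V₀ ⊓ V₁)}
    (hΦ' : ∀ a s, Φ' (a ⊗ₜ s) = a ⊗ₜ X.left.presheaf.map (homOfLE inf_le_right).op s) :
    a ≫ (W : Scheme.{u}).toSpecΓ ≫ Spec.map (CommRingCat.ofHom (Λ.comp (ψ.symm.toAlgHom.toRingHom.comp Φ.toRingHom))) =
      ((W' : Scheme.{u}).toSpecΓ ≫ Spec.map (CommRingCat.ofHom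
        (Λ'.comp (ψ'.symm.toAlgHom.toRingHom.comp Φ'.toRingHom)))) ≫ Spec.map (CommRingCat.ofHom σ₁) := by
  have hψσ' : ∀ x, σ₀₁ (ψ.symm x) = ψ'.symm (σ₀₁ x) := fun x => by
    rw [AlgEquiv.eq_symm_apply, ← hψσ, AlgEquiv.apply_symm_apply]
  have hnat := comp_chartRingHom_baseChange σ hV₀ p₀ hp₀ p₀' hp₀' hσ₀ a ha h₁ h₂ h₁' h₂' hσ₀₁
  rw [comp_toSpecΓ_SpecMap, Category.assoc, ← Spec.map_comp]
  apply toSpecΓ_SpecMap_congr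
  apply CommRingCat.hom_ext
  rw [CommRingCat.hom_comp, CommRingCat.hom_comp, CommRingCat.hom_ofHom, CommRingCat.hom_ofHom, CommRingCat.hom_ofHom]
  change (a.appTop.hom.comp Λ).comp (ψ.symm.toAlgHom.toRingHom.comp Φ.toRingHom) =
    (Λ'.comp (ψ'.symm.toAlgHom.toRingHom.comp Φ'.toRingHom)).comp σ₁
  rw [hnat, RingHom.comp_assoc, RingHom.comp_assoc]
  congr 1
  -- a pure tensor-level identity: `σ̂ ∘ ψ⁻¹ ∘ Φ = ψ'⁻¹ ∘ Φ' ∘ σ̂`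
  refine ringHom_ext_tmul (fun r => ?_) (fun c => ?_)
  · calc (σ₀₁.comp (ψ.symm.toAlgHom.toRingHom.comp Φ.toRingHom)) (r ⊗ₜ 1)
        = σ₀₁ (ψ.symm.toAlgHom.toRingHom (Φ (r ⊗ₜ 1))) := rfl
      _ = σ r ⊗ₜ 1 := by
          rw [baseChangeMap_tmul_one inf_le_right hΦ]
          exact (congrArg (fun y => σ₀₁ y) (algEquiv_tmul_one ψ.symm r)).trans (hσ₀₁ r 1)
      _ = ψ'.symm.toAlgHom.toRingHom (Φ' (σ₁ (r ⊗ₜ 1))) := by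
          rw [hσ₁, baseChangeMap_tmul_one inf_le_right hΦ']
          exact (algEquiv_tmul_one ψ'.symm (σ r)).symm
      _ = ((ψ'.symm.toAlgHom.toRingHom.comp Φ'.toRingHom).comp σ₁) (r ⊗ₜ 1) := rfl
  · calc (σ₀₁.comp (ψ.symm.toAlgHom.toRingHom.comp Φ.toRingHom)) (1 ⊗ₜ c)
        = σ₀₁ (ψ.symm (Φ (1 ⊗ₜ c))) := rfl
      _ = ψ'.symm (σ₀₁ (Φ (1 ⊗ₜ c))) := hψσ' _
      _ = ψ'.symm (Φ' (σ₁ (1 ⊗ₜ c))) := by rw [hΦ, hσ₀₁, map_one σ, hσ₁, map_one σ, hΦ']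
      _ = ((ψ'.symm.toAlgHom.toRingHom.comp Φ'.toRingHom).comp σ₁) (1 ⊗ₜ c) := rfl

end Literature.AlgebraicGeometry.Deformation

end
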